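import Summits.Ventures.PercRepro.SixFourResidueTwoPointsC

/-!
# PercRepro — C-025 at `(6,4)`: «plane + two points» solids at `t = 4`, part D (p2, gen 8 — Theorem 21.6): the bridges
`LPcnt_le` (a line-plus-point set is the image of `(cl C, C, y)`) and `pairOK_of_trace` (two distinct lines share
`≤ 1` point), and **`J_four_nonneg_of_plane_add_two`** — `0 ≤ J₄(G)` for every solid with `g ≤ 9` and a plane trace
with `g − 2` points (§21.18.3 (β), `k = 2`).
-/

namespace PercRepro.SixFour

open Finset ThmH

variable {α : Type*} [DecidableEq α] {M : Matroid α} [M.Finite] {G : Finset α}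

section Counts

variable (hs : Simple M) {τ : Finset α} (hτ : τ ⊆ gr M)
include hs hτ

/-- **`LP ≤ Σ_m inc_m·ε(m)·(p − m)`**: a line-plus-point set `S = C ∪ {y}` (`C = S ∖ y` collinear with `≥ 3`
points on the line `cl(C)`, `y ∈ τ` off that line) is the image of `(cl C, C, y)`. -/
theorem LPcnt_le (hr : M.eRk (τ : Set α) = 3) (h7 : τ.card ≤ 7) :
    (LPcnt M τ : ℤ) ≤ LPProf τ.card (inc M τ 3) (inc M τ 4) (inc M τ 5) (inc M τ 6) := by
  set T := (lines M).sigma (fun L => ((L ∩ τ).powerset.filter (fun C : Finset α => 3 ≤ C.card)) ×ˢ (τ \ L)) with hT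
  have hsurj : Set.SurjOn (fun q : Σ _ : Finset α, Finset α × α => insert q.2.2 q.2.1) (T : Set _)
      (((R3 M τ).filter (fun S => 4 ≤ S.card ∧ kcol M S = 1)) : Set (Finset α)) := by
    intro S hS
    rw [Finset.mem_coe, Finset.mem_filter] at hS
    obtain ⟨hS3, h4, hk⟩ := hS
    obtain ⟨hSτ, hr3⟩ := mem_R3.1 hS3
    unfold kcol at hk
    obtain ⟨y, hy⟩ := Finset.card_eq_one.1 hk
    have hyS : y ∈ S ∧ M.eRk ((S.erase y : Finset α) : Set α) ≤ 2 :=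
      Finset.mem_filter.1 (hy ▸ Finset.mem_singleton_self y)
    have hCτ : S.erase y ⊆ τ := (Finset.erase_subset y S).trans hSτ
    have hC3 : 3 ≤ (S.erase y).card := by rw [Finset.card_erase_of_mem hyS.1]; omega
    have hCr : M.eRk ((S.erase y : Finset α) : Set α) = 2 :=
      le_antisymm hyS.2 (two_le_eRk_of_two_le_card hs hτ hCτ (by omega))
    have hL := clF_mem_lines (hCτ.trans hτ) hCr
    refine ⟨⟨clF M (S.erase y), (S.erase y, y)⟩, ?_, ?_⟩
    · rw [Finset.mem_coe, hT, Finset.mem_sigma, Finset.mem_product, Finset.mem_filter, Finset.mem_powerset,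
        Finset.mem_sdiff]
      refine ⟨hL.1, ⟨Finset.subset_inter hL.2 hCτ, hC3⟩, hSτ hyS.1, ?_⟩
      intro hyL
      -- `S ⊆ cl(S ∖ y)` would give `r(S) ≤ 2`
      have hsub : (S : Set α) ⊆ M.closure ((S.erase y : Finset α) : Set α) := by
        intro z hz
        rw [Finset.mem_coe] at hz
        by_cases hzy : z = y
        · subst hzy
          rw [← coe_clF]
          exact Finset.mem_coe.2 hyL
        · exact M.subset_closure _ (by rw [← coe_gr]; exact_mod_cast hCτ.trans hτ)
            (Finset.mem_coe.2 (Finset.mem_erase.2 ⟨hzy, hz⟩))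
      have h3 : M.eRk (S : Set α) ≤ 2 := by
        calc M.eRk (S : Set α) ≤ M.eRk (M.closure ((S.erase y : Finset α) : Set α)) := M.eRk_mono hsub
          _ = M.eRk ((S.erase y : Finset α) : Set α) := M.eRk_closure_eq _
          _ ≤ 2 := hyS.2
      rw [hr3] at h3
      exact absurd h3 (by decide)
    · simp only
      exact Finset.insert_erase hyS.1
  have hcard : LPcnt M τ ≤ T.card := Finset.card_le_card_of_surjOn _ hsurj
  have hTcard : T.card = ∑ L ∈ lines M, eps (L ∩ τ).card * (τ.card - (L ∩ τ).card) := by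
    rw [hT, Finset.card_sigma]
    refine Finset.sum_congr rfl (fun L _ => ?_)
    rw [Finset.card_product, card_powerset_filter_three_le]
    congr 1
    have := Finset.card_sdiff_add_card_inter τ L
    rw [Finset.inter_comm] at this
    omega
  have e := sum_lines_eq_sum_inc (M := M) τ (fun n => eps n * (τ.card - n))
  rw [e, sum_inc_range_eight hr h7] at hTcard
  have hi7 : inc M τ 7 = 0 := inc_eq_zero_of_card_le hr (by omega)
  have he : eps 0 = 0 ∧ eps 1 = 0 ∧ eps 2 = 0 ∧ eps 3 = 1 ∧ eps 4 = 5 ∧ eps 5 = 16 ∧ eps 6 = 42 := by decide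
  obtain ⟨e0, e1, e2, e3, e4, e5, e6⟩ := he
  simp only [Finset.sum_range_succ, Finset.sum_range_zero, e0, e1, e2, e3, e4, e5, e6, hi7, mul_zero, zero_add,
    zero_mul, add_zero, one_mul] at hTcard
  unfold LPProf
  rw [hTcard] at hcard
  have hz := (Nat.cast_le (α := ℤ)).2 hcard
  push_cast at hz ⊢
  linarith

omit hτ in
/-- Two distinct lines share at most one point of `τ`: `|L ∩ τ| + |L′ ∩ τ| ≤ p + 1`. -/
theorem card_trace_add_card_trace_le {L L' : Finset α} (hL : L ∈ lines M) (hL' : L' ∈ lines M) (hne : L ≠ L') :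
    (L ∩ τ).card + (L' ∩ τ).card ≤ τ.card + 1 := by
  have hinter : ((L ∩ τ) ∩ (L' ∩ τ)).card ≤ 1 := by
    rw [Finset.card_le_one]
    intro u hu v hv
    by_contra huv
    simp only [Finset.mem_inter] at hu hv
    exact hne (lines_eq_of_two_mem hs hL hL' hu.1.1 hv.1.1 hu.2.1 hv.2.1 huv)
  have hunion : ((L ∩ τ) ∪ (L' ∩ τ)).card ≤ τ.card :=
    Finset.card_le_card (Finset.union_subset Finset.inter_subset_right Finset.inter_subset_right)
  have := Finset.card_union_add_card_inter (L ∩ τ) (L' ∩ τ)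
  omega

omit hs hτ in
/-- Two distinct lines with `m`-point traces exist when `inc_m ≥ 2`. -/
theorem exists_two_lines_of_inc (m : ℕ) (h : 2 ≤ inc M τ m) :
    ∃ L ∈ lines M, ∃ L' ∈ lines M, L ≠ L' ∧ (L ∩ τ).card = m ∧ (L' ∩ τ).card = m := by
  unfold inc at h
  obtain ⟨L, hL, L', hL', hne⟩ := Finset.one_lt_card.1 (by omega : 1 < ((lines M).filter (fun L : Finset α => (L ∩ τ).card = m)).card)
  rw [Finset.mem_filter] at hL hL'
  exact ⟨L, hL.1, L', hL'.1, hne, hL.2, hL'.2⟩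

omit hs hτ in
/-- A line with an `m`-point trace exists when `inc_m ≥ 1`. -/
theorem exists_line_of_inc (m : ℕ) (h : 1 ≤ inc M τ m) : ∃ L ∈ lines M, (L ∩ τ).card = m := by
  unfold inc at h
  obtain ⟨L, hL⟩ := Finset.card_pos.1 (by omega : 0 < ((lines M).filter (fun L : Finset α => (L ∩ τ).card = m)).card)
  rw [Finset.mem_filter] at hL
  exact ⟨L, hL.1, hL.2⟩

omit hτ in
/-- **`PairOK`** holds for the line profile of `τ`. -/
theorem pairOK_of_trace : PairOK τ.card (inc M τ 3) (inc M τ 4) (inc M τ 5) (inc M τ 6) := by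
  have same : ∀ m, 2 ≤ inc M τ m → 2 * m ≤ τ.card + 1 := by
    intro m hm
    obtain ⟨L, hL, L', hL', hne, h1, h2⟩ := exists_two_lines_of_inc m hm
    have := card_trace_add_card_trace_le hs (τ := τ) hL hL' hne
    omega
  have mixed : ∀ m m', m ≠ m' → 1 ≤ inc M τ m → 1 ≤ inc M τ m' → m + m' ≤ τ.card + 1 := by
    intro m m' hmm' hm hm'
    obtain ⟨L, hL, h1⟩ := exists_line_of_inc m hm
    obtain ⟨L', hL', h2⟩ := exists_line_of_inc m' hm'
    have hne : L ≠ L' := fun h => hmm' (by rw [← h1, ← h2, h])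
    have := card_trace_add_card_trace_le hs (τ := τ) hL hL' hne
    omega
  unfold PairOK
  refine ⟨fun h => ?_, fun h => ?_, fun h => ?_, fun h => ?_, fun h h' => ?_, fun h h' => ?_, fun h h' => ?_,
    fun h h' => ?_, fun h h' => ?_, fun h h' => ?_⟩
  · have := same 3 h; omega
  · have := same 4 h; omega
  · have := same 5 h; omega
  · have := same 6 h; omega
  · have := mixed 3 4 (by norm_num) h h'; omega
  · have := mixed 3 5 (by norm_num) h h'; omega
  · have := mixed 3 6 (by norm_num) h h'; omega
  · have := mixed 4 5 (by norm_num) h h'; omega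
  · have := mixed 4 6 (by norm_num) h h'; omega
  · have := mixed 5 6 (by norm_num) h h'; omega

end Counts

/-! ## Theorem 21.6 at `t = 4` for `g ≤ 9` -/

section Final

variable (hs : Simple M) (hG : G ⊆ gr M) (hr : M.eRk (G : Set α) = 4) {P₀ : Finset α} (hP₀ : P₀ ∈ planes M)
include hs hG hr hP₀

/-- **Theorem 21.6 at `t = 4`, `g ≤ 9` (§21.18.3 (β), `k = 2`)**: if some plane trace has `g − 2` points,
`0 ≤ J₄(G)`. -/
theorem J_four_nonneg_of_plane_add_two (hcard : (P₀ ∩ G).card + 2 = G.card) (hg : G.card ≤ 9) : 0 ≤ J M G 4 := by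
  obtain ⟨a, a', ht⟩ := twoOff_of_card (M := M) hcard
  have hτ : P₀ ∩ G ⊆ gr M := Finset.inter_subset_right.trans hG
  have hshares := J_four_ge_shares ht hG hr hP₀
  by_cases hr3 : M.eRk ((P₀ ∩ G : Finset α) : Set α) = 3
  · set τ := P₀ ∩ G with hτdef
    have h7 : τ.card ≤ 7 := by omega
    have hsum := share_sum_ge hs hτ
    have hdem := dem_sum_le (M := M) (τ := τ)
    -- the demanded sets are small: `#{|S| + 3 ≤ p} ≤ SmallProf`
    have hsmall : ((((R3 M τ).filter (fun S => S.card + 3 ≤ τ.card)).card : ℕ) : ℤ) ≤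
        SmallProf τ.card (inc M τ 3) (inc M τ 4) (inc M τ 5) (inc M τ 6) := by
      unfold SmallProf
      rw [← Tcnt_eq hs hτ hr3 h7, ← card_four_eq hs hτ hr3 h7]
      have hsub : (R3 M τ).filter (fun S => S.card + 3 ≤ τ.card) ⊆
          ((R3 M τ).filter (fun S => S.card = 3 ∧ 6 ≤ τ.card)) ∪ ((R3 M τ).filter (fun S => S.card = 4 ∧ 7 ≤ τ.card)) := by
        intro S hS
        rw [Finset.mem_filter] at hS
        rw [Finset.mem_union, Finset.mem_filter, Finset.mem_filter]
        have h3 : 3 ≤ S.card := three_le_card_of_eRk_eq_three (mem_R3.1 hS.1).2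
        rcases (show S.card = 3 ∨ S.card = 4 by omega) with h | h
        · exact Or.inl ⟨hS.1, h, by omega⟩
        · exact Or.inr ⟨hS.1, h, by omega⟩
      have h1 : ((R3 M τ).filter (fun S => S.card = 3 ∧ 6 ≤ τ.card)).card = if 6 ≤ τ.card then Tcnt M τ else 0 := by
        split_ifs with h6
        · unfold Tcnt
          congr 1
          exact Finset.filter_congr (fun S _ => by simp [h6])
        · rw [Finset.card_eq_zero, Finset.filter_eq_empty_iff]
          intro S _ h
          exact h6 h.2
      have h2 : ((R3 M τ).filter (fun S => S.card = 4 ∧ 7 ≤ τ.card)).card =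
          if 7 ≤ τ.card then ((R3 M τ).filter (fun S => S.card = 4)).card else 0 := by
        split_ifs with h7'
        · congr 1
          exact Finset.filter_congr (fun S _ => by simp [h7'])
        · rw [Finset.card_eq_zero, Finset.filter_eq_empty_iff]
          intro S _ h
          exact h7' h.2
      have hle : ((R3 M τ).filter (fun S => S.card + 3 ≤ τ.card)).card ≤
          ((R3 M τ).filter (fun S => S.card = 3 ∧ 6 ≤ τ.card)).card +
            ((R3 M τ).filter (fun S => S.card = 4 ∧ 7 ≤ τ.card)).card :=
        (Finset.card_le_card hsub).trans (Finset.card_union_le _ _)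
      rw [h1, h2] at hle
      have hz := (Nat.cast_le (α := ℤ)).2 hle
      push_cast at hz
      split_ifs at hz ⊢ <;> linarith
    obtain ⟨hb3, hb4, hb5, hb6⟩ := inc_bounds_of_trace hs hτ h7
    have hok := profileOK_of_trace hs hτ hr3 h7
    have hpair := pairOK_of_trace hs (τ := τ)
    have hineq := profIneq_of_profileOK h7 hb3 hb4 hb5 hb6 hok hpair
    unfold ProfIneq at hineq
    have hT := Tcnt_eq hs hτ hr3 h7
    have hD : ((D3cnt M τ : ℕ) : ℤ) = (D3Prof τ.card (inc M τ 4) (inc M τ 5) (inc M τ 6) : ℤ) := by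
      exact_mod_cast D3cnt_eq hs hτ hr3 h7
    have hLP := LPcnt_le hs hτ hr3 h7
    have hZ : 72 * ((((R3 M τ).filter (fun S => S.card + 3 ≤ τ.card)).card : ℕ) : ℤ) ≤
        39 * (Tcnt M τ : ℤ) + 120 * (D3cnt M τ : ℤ) - 50 * (LPcnt M τ : ℤ) := by
      rw [hT, hD]
      linarith
    have hQ : (72 : ℚ) * (((R3 M τ).filter (fun S => S.card + 3 ≤ τ.card)).card : ℚ) ≤
        39 * (Tcnt M τ : ℚ) + 120 * (D3cnt M τ : ℚ) - 50 * (LPcnt M τ : ℚ) := by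
      exact_mod_cast hZ
    linarith
  · -- `τ` has rank `≤ 2`: `R₃(τ) = ∅`, and the bound reads `0 ≤ J₄`
    have hempty : R3 M (P₀ ∩ G) = ∅ := by
      rw [Finset.eq_empty_iff_forall_notMem]
      intro S hS
      obtain ⟨hSτ, hS3⟩ := mem_R3.1 hS
      apply hr3
      refine le_antisymm ?_ (by rw [← hS3]; exact M.eRk_mono (Finset.coe_subset.2 hSτ))
      rw [← (mem_planes.1 hP₀).2.2]
      exact M.eRk_mono (Finset.coe_subset.2 Finset.inter_subset_left)
    rw [hempty, Finset.sum_empty, Finset.sum_empty] at hshares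
    linarith

end Final

end PercRepro.SixFour
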